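import Summits.BirchSwinnertonDyer.BirchSwinnertonDyer.Theorems.Rank2Observatory2DescClCurveCertDDefs
import HarnessLib

/-!
# BirchSwinnertonDyer — rank ≥ 2 observatory: KERNEL-2DESC-CL ΩD — the per-curve certificate over a dyadic-root-view field record, part 4/7: soundness lemmas

HONEST FRAMING: per-curve certified theorems and census instruments; no claim on BSD in rank ≥ 2.

Part 4 of 7: the `ω`-element `eltD` of a family entry and its algebra (`M·x = X(α)`, norm `N(X)/M³`, sign read
on `X`), the entry-level consequences of `famCheckD`, the three dyadic primes as height-one primes indexed by
their tags (`dyPrime`) with membership / non-membership from root-view certificates on `X`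
(`…2DescPadicRootMem`, `…2DescClFieldCertD.mem_rooted_of_memCheck`), soundness of the prime dispatch with TWO
auxiliary primes AND the dyadic dispatch (`dispatch_soundD`: a dispatched prime below `w ∋ x` is `q₁` or `q₂`, or
`w` is a support `α`-code prime — the other codes being excluded by `invCert` —, or `w` is a support dyadic
prime `Pᵢ` — the other `Pⱼ` being excluded by `notMemCheck`, all primes above `2` being `P₁, P₂, P₃` by
`cover₂_of_coreD`), and the support lemma `supp_of_famCheckD` (`x ∈ w ⇒ D·q₁q₂ ∈ w`).  Declaration text = E2Q2
part 5 (`…2DescClCurveCertE2Q2Sound`) with the `η`-view replaced by the `ω`-presentation and the dyadic block.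
New declarations only; sorry-free; axioms `propext`, `Classical.choice`, `Quot.sound`.
[cite: Cassels1991LecturesEllipticCurves, §15] [cite: Cohen1993, §4.8.2, §6.1] [cite: Marcus2018, Ch. 2, Thm. 4; Ch. 3, Thm. 22]
[cite: Cassels1986, Ch. 4 (Hensel's lemma)]
-/

set_option linter.dupNamespace false

noncomputable section

open scoped Classical NumberField nonZeroDivisors

open Literature.NumberTheory.NumberFields Polynomial Module NumberField IsDedekindDomain Ideal

namespace Summit.BirchSwinnertonDyer.BirchSwinnertonDyer.Rank2Observatory.TwoDescCl

open TwoDescCubic ClFieldCertQ2 TwoDescPadic ClFieldCertD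

/-! ## Soundness -/

section Sound

variable {K : Type*} [Field K] [NumberField K] {θ : K} (F : ClFieldCertDc)

/-- The `𝓞 K` element of an `ω`-family entry: `x = W₀ + W₁α + W₂ω`. -/
def eltD (hθ : aeval θ (MonicCubic.poly F.fd.base.a F.fd.base.b F.fd.base.c) = 0) (hD : F.fd.checkCoreD = true)
    (W : ℤ × ℤ × ℤ) : 𝓞 K :=
  omegaElt hθ (F.fd.aeval_omega hθ hD) W

variable {F}

/-- `M · x = X(α)` in `𝓞 K`. -/
theorem M_mul_eltD (hθ : aeval θ (MonicCubic.poly F.fd.base.a F.fd.base.b F.fd.base.c) = 0)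
    (hD : F.fd.checkCoreD = true) {X W : ℤ × ℤ × ℤ} (h : omegaCheck F.fd.u F.fd.d F.M X W = true) :
    (F.M : 𝓞 K) * eltD F hθ hD W = lin hθ X.1 X.2.1 X.2.2 :=
  natCast_mul_omegaElt hθ (F.fd.d_pos hD) (F.fd.aeval_omega hθ hD) h

/-- `M · x = X(α)` in `K`. -/
theorem M_mul_eltD_coe (hθ : aeval θ (MonicCubic.poly F.fd.base.a F.fd.base.b F.fd.base.c) = 0)
    (hD : F.fd.checkCoreD = true) {X W : ℤ × ℤ × ℤ} (h : omegaCheck F.fd.u F.fd.d F.M X W = true) :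
    (F.M : K) * algebraMap (𝓞 K) K (eltD F hθ hD W) = algebraMap (𝓞 K) K (lin hθ X.1 X.2.1 X.2.2) :=
  coe_omegaElt_of_omegaCheck hθ (F.fd.d_pos hD) (F.fd.aeval_omega hθ hD) h

/-- `(M : K) ≠ 0`. -/
theorem M_ne_zero_KD (hK : F.checkConst = true) : (F.M : K) ≠ 0 := Nat.cast_ne_zero.mpr (F.M_pos hK).ne'

/-- `(M : 𝓞 K) ≠ 0`. -/
theorem M_ne_zero_OD (hK : F.checkConst = true) : (F.M : 𝓞 K) ≠ 0 := Nat.cast_ne_zero.mpr (F.M_pos hK).ne'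

/-- An `ω`-element with non-zero `α`-norm form of `X` is non-zero. -/
theorem eltD_ne_zero (hθ : aeval θ (MonicCubic.poly F.fd.base.a F.fd.base.b F.fd.base.c) = 0)
    (h3 : finrank ℚ K = 3) (hD : F.fd.checkCoreD = true) {X W : ℤ × ℤ × ℤ}
    (h : omegaCheck F.fd.u F.fd.d F.M X W = true)
    (hN : normFormZ F.fd.base.a F.fd.base.b F.fd.base.c X.1 X.2.1 X.2.2 ≠ 0) : eltD F hθ hD W ≠ 0 :=
  omegaElt_ne_zero (F.fd.irreducible_of_coreD hD) hθ h3 (F.fd.d_pos hD) (F.fd.aeval_omega hθ hD) h hN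

/-- **Norm of an `ω`-element**: `N(x) = N(X) / M³`. [cite: Marcus2018, Ch. 2, Thm. 4] -/
theorem norm_eltD (hθ : aeval θ (MonicCubic.poly F.fd.base.a F.fd.base.b F.fd.base.c) = 0)
    (h3 : finrank ℚ K = 3) (hD : F.fd.checkCoreD = true) (hK : F.checkConst = true) {X W : ℤ × ℤ × ℤ}
    (h : omegaCheck F.fd.u F.fd.d F.M X W = true)
    (hdvd : ((F.M : ℤ)) ^ 3 ∣ normFormZ F.fd.base.a F.fd.base.b F.fd.base.c X.1 X.2.1 X.2.2) :
    Algebra.norm ℚ (algebraMap (𝓞 K) K (eltD F hθ hD W)) =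
      ((normFormZ F.fd.base.a F.fd.base.b F.fd.base.c X.1 X.2.1 X.2.2 / (F.M : ℤ) ^ 3 : ℤ) : ℚ) := by
  have hirr := F.fd.irreducible_of_coreD hD
  have e := M_mul_eltD_coe hθ hD h
  have hN := norm_lin_coords hirr hθ h3 X
  rw [RingOfIntegers.coe_eq_algebraMap, ← e, map_mul] at hN
  have hm : Algebra.norm ℚ ((F.M : K)) = (F.M : ℚ) ^ 3 := by
    rw [show ((F.M : K)) = algebraMap ℚ K (F.M : ℚ) by simp, Algebra.norm_algebraMap, h3]
  rw [hm] at hN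
  have hm0 : ((F.M : ℚ)) ^ 3 ≠ 0 := pow_ne_zero 3 (Nat.cast_ne_zero.mpr (F.M_pos hK).ne')
  have hm0' : (((F.M : ℤ) ^ 3 : ℤ) : ℚ) ≠ 0 := by push_cast; exact hm0
  rw [Int.cast_div hdvd hm0']
  push_cast
  rw [eq_div_iff hm0]
  linear_combination hN

/-- **Sign of an `ω`-element at a real place** (read on `X`, `M > 0`). [folklore] -/
theorem rho_eltD (hθ : aeval θ (MonicCubic.poly F.fd.base.a F.fd.base.b F.fd.base.c) = 0)
    (hD : F.fd.checkCoreD = true) {X W : ℤ × ℤ × ℤ} (h : omegaCheck F.fd.u F.fd.d F.M X W = true)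
    (ρ : K →+* ℝ) :
    ρ ((lin hθ X.1 X.2.1 X.2.2 : 𝓞 K) : K) = (F.M : ℝ) * ρ (algebraMap (𝓞 K) K (eltD F hθ hD W)) := by
  rw [RingOfIntegers.coe_eq_algebraMap, ← M_mul_eltD_coe hθ hD h, map_mul, map_natCast]

/-! ### Entry-level consequences of `famCheckD` -/

variable {cc : ClCurveCertD} {f : FamEntryD}

/-- The `ω`-consistency clause of a checked family entry. -/
theorem ov_of_famCheckD (h : famCheckD F cc f = true) : omegaCheck F.fd.u F.fd.d F.M f.X f.W = true := by
  simp only [famCheckD, Bool.and_eq_true] at h; exact h.1.1.1.1.1.1.1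

/-- The sign clause of a checked family entry. -/
theorem signCond_of_famCheckD (h : famCheckD F cc f = true) :
    signCond F.fd.base.lo F.fd.base.hi f.X f.sg = true := by
  simp only [famCheckD, Bool.and_eq_true] at h; exact h.1.1.1.1.1.1.2

/-- The norm form of `X` of a checked family entry is non-zero. -/
theorem normFormZ_ne_of_famCheckD (h : famCheckD F cc f = true) :
    normFormZ F.fd.base.a F.fd.base.b F.fd.base.c f.X.1 f.X.2.1 f.X.2.2 ≠ 0 := by
  simp only [famCheckD, Bool.and_eq_true, decide_eq_true_eq] at h; exact h.1.1.1.1.1.2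

/-- The norm-divisibility clause of a checked family entry. -/
theorem dvd_of_famCheckD (h : famCheckD F cc f = true) :
    ((F.M : ℤ)) ^ 3 ∣ normFormZ F.fd.base.a F.fd.base.b F.fd.base.c f.X.1 f.X.2.1 f.X.2.2 := by
  simp only [famCheckD, Bool.and_eq_true, decide_eq_true_eq] at h; exact h.1.1.1.1.2

/-- The non-divisibility clause of a checked family entry at the residue characters. -/
theorem not_dvd_evalInt_of_famCheckD (h : famCheckD F cc f = true) {ch : ℕ × ℤ × ℤ}
    (hch : ch ∈ F.fd.base.chars) : ¬ (ch.1 : ℤ) ∣ evalInt ch.2.1 f.X := by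
  simp only [famCheckD, Bool.and_eq_true, List.all_eq_true, Bool.not_eq_true', decide_eq_false_iff_not] at h
  exact h.1.1.1.2 ch hch

/-- The absolute-norm clause of a checked family entry. -/
theorem natAbs_of_famCheckD (h : famCheckD F cc f = true) :
    (normFormZ F.fd.base.a F.fd.base.b F.fd.base.c f.X.1 f.X.2.1 f.X.2.2).natAbs =
      (f.nf.map fun pe => pe.1 ^ pe.2).prod := by
  simp only [famCheckD, Bool.and_eq_true, decide_eq_true_eq] at h; exact h.1.1.2

/-- The per-prime dispatch clause of a checked family entry. -/
theorem dispatch_of_famCheckD (h : famCheckD F cc f = true) :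
    ∀ pe ∈ f.nf, primeDispatchD F cc f.X f.invsA pe.1 = true := by
  simp only [famCheckD, Bool.and_eq_true, List.all_eq_true] at h; exact h.1.2

/-- The kind clause of a checked family entry. -/
theorem kind_of_famCheckD (h : famCheckD F cc f = true) : famKindCheckD F f = true := by
  simp only [famCheckD, Bool.and_eq_true] at h; exact h.2

/-! ### The three dyadic primes by tag -/

/-- The height-one prime of the dyadic tag `i` (`1 ↦ P₁`, `2 ↦ P₂`, otherwise `P₃`), given the three rooted primes. -/
def dyPrime {ra₁ ra₂ ra₃ : ℤ} {N : ℕ} (R₁ : RootedPrime θ 2 ra₁ N) (R₂ : RootedPrime θ 2 ra₂ N)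
    (R₃ : RootedPrime θ 2 ra₃ N) (i : ℕ) : HeightOneSpectrum (𝓞 K) :=
  if i = 1 then R₁.spec else if i = 2 then R₂.spec else R₃.spec

section DyPrime

variable {ra₁ ra₂ ra₃ : ℤ} {N : ℕ} (R₁ : RootedPrime θ 2 ra₁ N) (R₂ : RootedPrime θ 2 ra₂ N)
  (R₃ : RootedPrime θ 2 ra₃ N)

/-- `dyPrime` at index `1` is the prime of the first root triple. -/
theorem dyPrime_one : dyPrime R₁ R₂ R₃ 1 = R₁.spec := by simp [dyPrime]

/-- `dyPrime` at index `2` is the prime of the second root triple. -/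
theorem dyPrime_two : dyPrime R₁ R₂ R₃ 2 = R₂.spec := by simp [dyPrime]

/-- `dyPrime` at any index other than `1` and `2` is the prime of the third root triple. -/
theorem dyPrime_of_ne {i : ℕ} (h1 : i ≠ 1) (h2 : i ≠ 2) : dyPrime R₁ R₂ R₃ i = R₃.spec := by simp [dyPrime, h1, h2]

end DyPrime

/-- `F.P i = P₃` off the tags `1, 2`. -/
theorem ClFieldCertDc.P_of_ne (F : ClFieldCertDc) {i : ℕ} (h1 : i ≠ 1) (h2 : i ≠ 2) : F.P i = F.fd.P₃ := by
  simp [ClFieldCertDc.P, h1, h2]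

variable (R₁ : RootedPrime θ 2 F.fd.P₁.ra F.fd.N) (R₂ : RootedPrime θ 2 F.fd.P₂.ra F.fd.N)
  (R₃ : RootedPrime θ 2 F.fd.P₃.ra F.fd.N)

/-- **`x ∈ Pᵢ`** from a root-view membership certificate on `X = M·x` at the tag `i`. [cite: Cassels1986, Ch. 4] -/
theorem mem_dyPrime_of_memCheck (hθ : aeval θ (MonicCubic.poly F.fd.base.a F.fd.base.b F.fd.base.c) = 0)
    (hD : F.fd.checkCoreD = true) {i : ℕ} {X W : ℤ × ℤ × ℤ} (hov : omegaCheck F.fd.u F.fd.d F.M X W = true)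
    (hc : memCheck 2 (F.P i).ra F.fd.N (F.M : ℤ) F.vM X.1 X.2.1 X.2.2 = true) :
    eltD F hθ hD W ∈ (dyPrime R₁ R₂ R₃ i).asIdeal := by
  by_cases h1 : i = 1
  · subst h1
    rw [F.P_one] at hc
    rw [dyPrime_one]
    exact mem_rooted_of_memCheck hθ hD R₁ hov hc
  by_cases h2 : i = 2
  · subst h2
    rw [F.P_two] at hc
    rw [dyPrime_two]
    exact mem_rooted_of_memCheck hθ hD R₂ hov hc
  rw [F.P_of_ne h1 h2] at hc
  rw [dyPrime_of_ne R₁ R₂ R₃ h1 h2]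
  exact mem_rooted_of_memCheck hθ hD R₃ hov hc

/-- **`x ∉ Pᵢ`** from a root-view non-membership certificate on `X = M·x` at the tag `i`. [cite: Cassels1986, Ch. 4] -/
theorem not_mem_dyPrime_of_notMemCheck (hθ : aeval θ (MonicCubic.poly F.fd.base.a F.fd.base.b F.fd.base.c) = 0)
    (hD : F.fd.checkCoreD = true) {i : ℕ} {X W : ℤ × ℤ × ℤ} (hov : omegaCheck F.fd.u F.fd.d F.M X W = true)
    (hc : notMemCheck 2 (F.P i).ra F.fd.N (F.M : ℤ) F.vM X.1 X.2.1 X.2.2 = true) :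
    eltD F hθ hD W ∉ (dyPrime R₁ R₂ R₃ i).asIdeal := by
  by_cases h1 : i = 1
  · subst h1
    rw [F.P_one] at hc
    rw [dyPrime_one]
    exact not_mem_rooted_of_notMemCheck hθ hD R₁ hov hc
  by_cases h2 : i = 2
  · subst h2
    rw [F.P_two] at hc
    rw [dyPrime_two]
    exact not_mem_rooted_of_notMemCheck hθ hD R₂ hov hc
  rw [F.P_of_ne h1 h2] at hc
  rw [dyPrime_of_ne R₁ R₂ R₃ h1 h2]
  exact not_mem_rooted_of_notMemCheck hθ hD R₃ hov hc

/-! ### The prime dispatch is sound -/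

/-- The avatar `X(α) = M·x` lies in any prime containing `x`. -/
theorem avatar_memD (hθ : aeval θ (MonicCubic.poly F.fd.base.a F.fd.base.b F.fd.base.c) = 0)
    (hD : F.fd.checkCoreD = true) {X W : ℤ × ℤ × ℤ} (h : omegaCheck F.fd.u F.fd.d F.M X W = true)
    (w : HeightOneSpectrum (𝓞 K)) (hx : eltD F hθ hD W ∈ w.asIdeal) : lin hθ X.1 X.2.1 X.2.2 ∈ w.asIdeal := by
  rw [← M_mul_eltD hθ hD h]
  exact Ideal.mul_mem_left _ _ hx

/-- **Soundness of the prime dispatch**: if `x ∈ w`, `M x = X(α)`, and a rational prime `l ∈ w` is dispatched,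
then `w` lies above `q₁` or `q₂`, or `w` is the prime of a support `α`-code (and `M ∉ w`), or `w` is a support
dyadic prime. [folklore] -/
theorem dispatch_soundD (hθ : aeval θ (MonicCubic.poly F.fd.base.a F.fd.base.b F.fd.base.c) = 0)
    (h3 : finrank ℚ K = 3) (hD : F.fd.checkCoreD = true) (hK : F.checkConst = true)
    (hpr : F.fd.base.primeList.Forall Nat.Prime) {X W : ℤ × ℤ × ℤ}
    (hov : omegaCheck F.fd.u F.fd.d F.M X W = true) {invsA : List (PCode × (ℤ × ℤ × ℤ))}
    {l : ℕ} (hdisp : primeDispatchD F cc X invsA l = true) (w : HeightOneSpectrum (𝓞 K))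
    (hlw : (l : 𝓞 K) ∈ w.asIdeal) (hx : eltD F hθ hD W ∈ w.asIdeal) :
    (((F.fd.base.q₁ : ℕ) : 𝓞 K) ∈ w.asIdeal ∨ ((F.fd.base.q₂ : ℕ) : 𝓞 K) ∈ w.asIdeal) ∨
      (∃ C, ((0 : ℕ), C) ∈ cc.codes.map Prod.fst ∧ (F.fd.base.primes.any fun e => e.p == C.1) = true ∧
        C ∈ (F.fd.base.row C.1).codes ∧ w.asIdeal = idealOf hθ C ∧ (F.M : 𝓞 K) ∉ w.asIdeal) ∨
      (∃ i, i ≠ 0 ∧ (cc.codes.any fun bc => bc.1.1 == i) = true ∧ w = dyPrime R₁ R₂ R₃ i) := by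
  have hR := F.fd.checkReg_of_coreD hD
  have hirr := F.fd.irreducible_of_coreD hD
  have hX := avatar_memD hθ hD hov w hx
  simp only [primeDispatchD, Bool.or_eq_true, Bool.and_eq_true, beq_iff_eq, List.all_eq_true, List.any_eq_true,
    decide_eq_true_eq] at hdisp
  rcases hdisp with ((rfl | rfl) | ⟨hany, hall⟩) | ⟨rfl, hdy⟩
  · exact Or.inl (Or.inl hlw)
  · exact Or.inl (Or.inr hlw)
  · have hany' : (F.fd.base.primes.any fun e => e.p == l) = true := by simpa [List.any_eq_true] using hany
    obtain ⟨hrow, hrowp⟩ := row_mem hany'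
    have hpp : (F.fd.base.row l).p.Prime := F.fd.base.prime_of_mem hpr hrow
    have hlw' : ((F.fd.base.row l).p : 𝓞 K) ∈ w.asIdeal := by rw [hrowp]; exact hlw
    obtain ⟨C', hC', hw'⟩ :=
      exists_code_of_natCast_mem hirr hθ h3 hpp (F.fd.base.row_check_of_mem_reg hR hrow).1 w hlw'
    rcases hall C' hC' with hmem | ⟨ci, -, hci, hinv⟩
    · refine Or.inr (Or.inl ⟨C', hmem, ?_, ?_, hw', ?_⟩)
      · rw [code_fst_of_mem hC', hrowp]; exact hany'
      · rw [code_fst_of_mem hC', hrowp]; exact hC'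
      · have hcop := F.coprime_row hK hrow
        rw [hrowp] at hcop
        exact natCast_not_mem_of_coprime w hlw hcop
    · exact absurd hX (lin_not_mem_of_invCert hθ w hw' hinv)
  · simp only [dyDispatchD, List.all_cons, List.all_nil, Bool.and_true, Bool.and_eq_true, Bool.or_eq_true]
      at hdy
    obtain ⟨h₁, h₂, h₃⟩ := hdy
    rcases (F.fd.cover₂_of_coreD hθ h3 hD R₁ R₂ R₃).2 w hlw with rfl | rfl | rfl
    · rcases h₁ with hs | hn
      · exact Or.inr (Or.inr ⟨1, one_ne_zero, hs, (dyPrime_one R₁ R₂ R₃).symm⟩)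
      · rw [F.P_one] at hn
        exact absurd hx (not_mem_rooted_of_notMemCheck hθ hD R₁ hov hn)
    · rcases h₂ with hs | hn
      · exact Or.inr (Or.inr ⟨2, two_ne_zero, hs, (dyPrime_two R₁ R₂ R₃).symm⟩)
      · rw [F.P_two] at hn
        exact absurd hx (not_mem_rooted_of_notMemCheck hθ hD R₂ hov hn)
    · rcases h₃ with hs | hn
      · exact Or.inr (Or.inr ⟨3, by omega, hs, (dyPrime_of_ne R₁ R₂ R₃ (by omega) (by omega)).symm⟩)
      · rw [F.P_three] at hn
        exact absurd hx (not_mem_rooted_of_notMemCheck hθ hD R₃ hov hn)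

/-- A rational prime below a prime containing `X(α)`, read on the `α`-norm form of `X`. -/
theorem exists_prime_of_memD (hθ : aeval θ (MonicCubic.poly F.fd.base.a F.fd.base.b F.fd.base.c) = 0)
    (h3 : finrank ℚ K = 3) (hD : F.fd.checkCoreD = true) {X : ℤ × ℤ × ℤ}
    (hN : normFormZ F.fd.base.a F.fd.base.b F.fd.base.c X.1 X.2.1 X.2.2 ≠ 0) {nf : List (ℕ × ℕ)}
    (hnf : (normFormZ F.fd.base.a F.fd.base.b F.fd.base.c X.1 X.2.1 X.2.2).natAbs =
      (nf.map fun pe => pe.1 ^ pe.2).prod)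
    (w : HeightOneSpectrum (𝓞 K)) (hX : lin hθ X.1 X.2.1 X.2.2 ∈ w.asIdeal) :
    ∃ pe ∈ nf, (pe.1 : 𝓞 K) ∈ w.asIdeal := by
  have hirr := F.fd.irreducible_of_coreD hD
  have hX0 : lin hθ X.1 X.2.1 X.2.2 ≠ 0 := lin_ne_zero_of_coords hirr hθ h3 X hN
  obtain ⟨l, hl, hldvd, hlw⟩ := exists_prime_dvd_norm_mem w hX0 hX
  rw [natAbs_norm_lin_coords hirr hθ h3, hnf] at hldvd
  obtain ⟨a, ha, hla⟩ := (Prime.dvd_prod_iff hl.prime).mp hldvd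
  obtain ⟨pe, hpe, rfl⟩ := List.mem_map.mp ha
  obtain ⟨k, hk⟩ := hl.dvd_of_dvd_pow hla
  refine ⟨pe, hpe, ?_⟩
  rw [hk, Nat.cast_mul]
  exact Ideal.mul_mem_right _ _ hlw

/-! ### The support-code clause -/

/-- The support-code clause, `α`-code branch (tag `0`). -/
theorem codeClauseD_zero {bc : (ℕ × PCode) × FamEntryD} (h : codeClauseD F cc bc = true) (hb : bc.1.1 = 0) :
    (F.fd.base.primes.any fun e => e.p == bc.1.2.1) = true ∧ bc.1.2 ∈ (F.fd.base.row bc.1.2.1).codes ∧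
      memCode bc.1.2 cc.XD = true := by
  unfold codeClauseD at h
  rw [if_pos hb] at h
  simp only [Bool.and_eq_true, decide_eq_true_eq] at h
  exact ⟨h.1.1, h.1.2, h.2⟩

/-- The support-code clause, dyadic branch (tag `i ≠ 0`). -/
theorem codeClauseD_ne {bc : (ℕ × PCode) × FamEntryD} (h : codeClauseD F cc bc = true) (hb : bc.1.1 ≠ 0) :
    memCheck 2 (F.P bc.1.1).ra F.fd.N (F.M : ℤ) F.vM cc.XD.1 cc.XD.2.1 cc.XD.2.2 = true := by
  unfold codeClauseD at h
  rw [if_neg hb] at h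
  exact h

/-! ### Support of a family element -/

include R₁ R₂ R₃ in
/-- **Support**: every prime containing the family element `x` contains `D · q₁q₂`.
[cite: Cassels1991LecturesEllipticCurves, §15] -/
theorem supp_of_famCheckD (hθ : aeval θ (MonicCubic.poly F.fd.base.a F.fd.base.b F.fd.base.c) = 0)
    (h3 : finrank ℚ K = 3) (hD : F.fd.checkCoreD = true) (hK : F.checkConst = true)
    (hpr : F.fd.base.primeList.Forall Nat.Prime) (hcodes : ∀ bc ∈ cc.codes, codeClauseD F cc bc = true)
    (hovD : omegaCheck F.fd.u F.fd.d F.M cc.XD cc.WD = true) (h : famCheckD F cc f = true) :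
    ∀ v : HeightOneSpectrum (𝓞 K), eltD F hθ hD f.W ∈ v.asIdeal →
      eltD F hθ hD cc.WD * ((F.fd.base.q₁ * F.fd.base.q₂ : ℕ) : 𝓞 K) ∈ v.asIdeal := by
  intro v hv
  have hXv := avatar_memD hθ hD (ov_of_famCheckD h) v hv
  obtain ⟨pe, hpe, hpv⟩ :=
    exists_prime_of_memD hθ h3 hD (normFormZ_ne_of_famCheckD h) (natAbs_of_famCheckD h) v hXv
  rcases dispatch_soundD (cc := cc) R₁ R₂ R₃ hθ h3 hD hK hpr (ov_of_famCheckD h) (dispatch_of_famCheckD h pe hpe)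
      v hpv hv with
    (hq | hq) | ⟨C, hmem, -, -, hw, hM⟩ | ⟨i, hi, hany, hw⟩
  · rw [natCast_q₁q₂]; exact Ideal.mul_mem_left _ _ (Ideal.mul_mem_right _ _ hq)
  · rw [natCast_q₁q₂]; exact Ideal.mul_mem_left _ _ (Ideal.mul_mem_left _ _ hq)
  · obtain ⟨bc, hbc, hbc1⟩ := List.mem_map.mp hmem
    obtain ⟨-, -, hmc⟩ := codeClauseD_zero (hcodes bc hbc) (by rw [hbc1])
    have hC : bc.1.2 = C := by rw [hbc1]
    rw [hC] at hmc
    have hXD : lin hθ cc.XD.1 cc.XD.2.1 cc.XD.2.2 ∈ v.asIdeal := lin_mem_of_memCode hθ v hw cc.XD hmc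
    exact Ideal.mul_mem_right _ _ ((mem_iff_of_natCast_mul_eq v hM (M_mul_eltD hθ hD hovD)).mpr hXD)
  · obtain ⟨bc, hbc, hbci⟩ := List.any_eq_true.mp hany
    rw [beq_iff_eq] at hbci
    have hmc := codeClauseD_ne (hcodes bc hbc) (by rw [hbci]; exact hi)
    rw [hbci] at hmc
    have hDv : eltD F hθ hD cc.WD ∈ v.asIdeal := by
      rw [hw]; exact mem_dyPrime_of_memCheck R₁ R₂ R₃ hθ hD hovD hmc
    exact Ideal.mul_mem_right _ _ hDv

/-! ### Sign, real non-vanishing -/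

/-- **Sign of a checked family element at the real place** (read on `X`, as `M > 0`). [folklore] -/
theorem sign_iff_of_famCheckD (hθ : aeval θ (MonicCubic.poly F.fd.base.a F.fd.base.b F.fd.base.c) = 0)
    (ρ : K →+* ℝ) (hlo : ((F.fd.base.lo : ℚ) : ℝ) < ρ θ) (hhi : ρ θ < ((F.fd.base.hi : ℚ) : ℝ))
    (h0 : 0 ≤ F.fd.base.lo) (hD : F.fd.checkCoreD = true) (hK : F.checkConst = true)
    (h : famCheckD F cc f = true) :
    (f.sg = true ↔ ρ (algebraMap (𝓞 K) K (eltD F hθ hD f.W)) < 0) := by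
  have h1 := sign_iff_of_signCond hθ ρ h0 hlo hhi (signCond_of_famCheckD h)
  rw [rho_eltD hθ hD (ov_of_famCheckD h) ρ] at h1
  have hm : (0 : ℝ) < F.M := Nat.cast_pos.mpr (F.M_pos hK)
  rw [h1]
  constructor
  · intro hneg
    by_contra hc
    push Not at hc
    nlinarith
  · intro hneg
    exact mul_neg_of_pos_of_neg hm hneg

/-- A checked family element is non-zero at the real place. [folklore] -/
theorem rho_ne_zero_of_famCheckD (hθ : aeval θ (MonicCubic.poly F.fd.base.a F.fd.base.b F.fd.base.c) = 0)
    (ρ : K →+* ℝ) (hlo : ((F.fd.base.lo : ℚ) : ℝ) < ρ θ) (hhi : ρ θ < ((F.fd.base.hi : ℚ) : ℝ))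
    (h0 : 0 ≤ F.fd.base.lo) (hD : F.fd.checkCoreD = true) (h : famCheckD F cc f = true) :
    ρ (algebraMap (𝓞 K) K (eltD F hθ hD f.W)) ≠ 0 := by
  have h1 := rho_lin_ne_zero_of_signCond hθ ρ h0 hlo hhi (signCond_of_famCheckD h)
  rw [rho_eltD hθ hD (ov_of_famCheckD h) ρ] at h1
  exact (mul_ne_zero_iff.mp h1).2

end Sound

end Summit.BirchSwinnertonDyer.BirchSwinnertonDyer.Rank2Observatory.TwoDescCl
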